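import Literature.AlgebraicGeometry.ShimuraVarieties.UnitaryBallQuotientDatum

/-!
# Entries of an element of `U(p,1)` are bounded by its corner entry (crux
# `EndoscopicMiddleDegree.OrthogonalEnveloped`, stmt-HodgeConjecture-14300; `--supports`; seat c2, 2026-08-16)

A brick of the registered residual stub `stub_properlyDiscontinuous` ("`Γ` acts properly discontinuously
on the ball"; plan step (iii) in the crux notes): for a complex matrix `g` preserving the standard
hermitian form `S = diag(1,…,1,-1)` of signature `(p,1)` on both sides (`gᴴ S g = S = g S gᴴ`), EVERY entry
satisfies `|g i j| ≤ |g_{last,last}|`. Column `j < last`: `Σ_{i<last}|g i j|² = 1 + |g_{last,j}|²`; column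
`last`: `Σ_{i<last}|g_{i,last}|² = |g_{last,last}|² - 1`; last row: `Σ_{j<last}|g_{last,j}|² =
|g_{last,last}|² - 1`; combine. So a subset of `U(p,1)` is bounded as soon as its corner entries are,
i.e. as soon as it moves the base point of the ball into a compact set — the archimedean half of the
finiteness `{γ ∈ Γ | γK ∩ L ≠ ∅}`.

* `stub_indefiniteUnitaryEntryBound` (REGISTERED stub of the crux).

References: standard (e.g. W. Goldman, *Complex Hyperbolic Geometry* (1999), §3.1); BMM arXiv:1306.1515 Part 2 §1.1.
-/

noncomputable section

-- The crux-workfile namespace `Summit.<P>.<Sub>.Cruxes.…` repeats `HodgeConjecture` (single-conjunct summit).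
set_option linter.dupNamespace false

namespace Summit.HodgeConjecture.HodgeConjecture.Cruxes.OrthogonalEnveloped.HeckeGraphChow

open scoped BigOperators ComplexConjugate
open Matrix Literature.AlgebraicGeometry.ShimuraVarieties

/-- The diagonal quadratic expression `Σ_k conj(u k) · s_k · v k` of the signature matrix: the
`(i, j)` entry of `Aᴴ S B` resp. of `A S Bᴴ`. [folklore] -/
theorem conjTranspose_mul_signatureMatrix_mul_apply {p : ℕ} (A B : Matrix (Fin (p + 1)) (Fin (p + 1)) ℂ)
    (i j : Fin (p + 1)) :
    (Aᴴ * signatureMatrix p * B) i j =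
      ∑ k, conj (A k i) * (if k = Fin.last p then -1 else 1) * B k j := by
  rw [Matrix.mul_apply]
  refine Finset.sum_congr rfl fun k _ ↦ ?_
  rw [signatureMatrix, Matrix.mul_diagonal, Matrix.conjTranspose_apply, Complex.star_def]

/-- Same for `A S Bᴴ`. [folklore] -/
theorem mul_signatureMatrix_mul_conjTranspose_apply {p : ℕ} (A B : Matrix (Fin (p + 1)) (Fin (p + 1)) ℂ)
    (i j : Fin (p + 1)) :
    (A * signatureMatrix p * Bᴴ) i j =
      ∑ k, A i k * (if k = Fin.last p then -1 else 1) * conj (B j k) := by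
  rw [Matrix.mul_apply]
  refine Finset.sum_congr rfl fun k _ ↦ ?_
  rw [signatureMatrix, Matrix.mul_diagonal, Matrix.conjTranspose_apply, Complex.star_def]

/-- Splitting a signed sum of squared moduli at the last index:
`Σ_k conj(u k) s_k (u k) = Σ_{k<last} |u k|² - |u last|²` (as a real number).
[folklore] -/
theorem sum_conj_mul_sign_mul_self {p : ℕ} (u : Fin (p + 1) → ℂ) :
    ∑ k, conj (u k) * (if k = Fin.last p then -1 else 1) * u k =
      ((∑ k : Fin p, Complex.normSq (u k.castSucc) - Complex.normSq (u (Fin.last p)) : ℝ) : ℂ) := by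
  rw [Fin.sum_univ_castSucc]
  simp only [Fin.castSucc_ne_last, if_false, if_true, mul_one, Complex.ofReal_sub,
    Complex.ofReal_sum, Complex.normSq_eq_conj_mul_self]
  ring

/-- **REGISTERED STUB `stub_indefiniteUnitaryEntryBound` (seat c2): the entries of an element of
`U(p,1)` are bounded by its corner entry.** For `g` with `gᴴ S g = S` and `g S gᴴ = S`,
`S = signatureMatrix p = diag(1, …, 1, -1)`: `‖g i j‖ ≤ ‖g last last‖` for all `i, j`.
[cite: BergeronMillsonMoeglin2016Balls, Part 2 §1.1] -/
theorem stub_indefiniteUnitaryEntryBound :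
    ∀ (p : ℕ) (g : Matrix (Fin (p + 1)) (Fin (p + 1)) ℂ),
      gᴴ * signatureMatrix p * g = signatureMatrix p →
      g * signatureMatrix p * gᴴ = signatureMatrix p →
      ∀ i j, ‖g i j‖ ≤ ‖g (Fin.last p) (Fin.last p)‖ := by
  intro p g h1 h2 i j
  -- the three quadratic identities
  have hcol : ∀ j : Fin (p + 1),
      ((∑ k : Fin p, Complex.normSq (g k.castSucc j) - Complex.normSq (g (Fin.last p) j) : ℝ) : ℂ) =
        if j = Fin.last p then -1 else 1 := by
    intro j
    have h : (gᴴ * signatureMatrix p * g) j j = signatureMatrix p j j := by rw [h1]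
    rwa [conjTranspose_mul_signatureMatrix_mul_apply, sum_conj_mul_sign_mul_self (fun k ↦ g k j),
      signatureMatrix, Matrix.diagonal_apply_eq] at h
  have hcolOff : ∀ j' : Fin p,
      ∑ k : Fin p, Complex.normSq (g k.castSucc j'.castSucc) -
        Complex.normSq (g (Fin.last p) j'.castSucc) = 1 := by
    intro j'
    have h := hcol j'.castSucc
    rw [if_neg (Fin.castSucc_ne_last j')] at h
    exact_mod_cast h
  have hcolLast : ∑ k : Fin p, Complex.normSq (g k.castSucc (Fin.last p)) -
      Complex.normSq (g (Fin.last p) (Fin.last p)) = -1 := by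
    have h := hcol (Fin.last p)
    rw [if_pos rfl] at h
    exact_mod_cast h
  have hrow : ∑ k : Fin p, Complex.normSq (g (Fin.last p) k.castSucc) -
      Complex.normSq (g (Fin.last p) (Fin.last p)) = -1 := by
    have h : (g * signatureMatrix p * gᴴ) (Fin.last p) (Fin.last p) =
        signatureMatrix p (Fin.last p) (Fin.last p) := by rw [h2]
    rw [mul_signatureMatrix_mul_conjTranspose_apply, signatureMatrix, Matrix.diagonal_apply_eq,
      if_pos rfl] at h
    have h' : ∑ k, conj (g (Fin.last p) k) * (if k = Fin.last p then -1 else 1) * g (Fin.last p) k =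
        -1 :=
      (Finset.sum_congr rfl fun k _ ↦ by ring).trans h
    rw [sum_conj_mul_sign_mul_self (fun k ↦ g (Fin.last p) k)] at h'
    exact_mod_cast h'
  -- abbreviations
  set B := Complex.normSq (g (Fin.last p) (Fin.last p)) with hB
  have hnn : ∀ (k j : Fin (p + 1)), 0 ≤ Complex.normSq (g k j) := fun _ _ ↦ Complex.normSq_nonneg _
  -- last row, off-corner: `|g last j'|² ≤ B - 1`
  have hrow' : ∀ j' : Fin p, Complex.normSq (g (Fin.last p) j'.castSucc) ≤ B - 1 := by
    intro j'
    have hle : Complex.normSq (g (Fin.last p) j'.castSucc) ≤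
        ∑ k : Fin p, Complex.normSq (g (Fin.last p) k.castSucc) :=
      Finset.single_le_sum (fun k _ ↦ hnn _ _) (Finset.mem_univ j')
    linarith
  -- every squared modulus is at most `B`
  have key : Complex.normSq (g i j) ≤ B := by
    rcases Fin.eq_castSucc_or_eq_last j with ⟨j', rfl⟩ | rfl
    · -- column `j' < last`: `Σ_{k<last} |g k j'|² = 1 + |g last j'|² ≤ B`
      have hc := hcolOff j'
      rcases Fin.eq_castSucc_or_eq_last i with ⟨i', rfl⟩ | rfl
      · have hle : Complex.normSq (g i'.castSucc j'.castSucc) ≤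
            ∑ k : Fin p, Complex.normSq (g k.castSucc j'.castSucc) :=
          Finset.single_le_sum (fun k _ ↦ hnn _ _) (Finset.mem_univ i')
        have := hrow' j'
        linarith
      · have := hrow' j'
        linarith
    · -- column `last`: `Σ_{k<last} |g k last|² = B - 1`
      have hc := hcolLast
      rcases Fin.eq_castSucc_or_eq_last i with ⟨i', rfl⟩ | rfl
      · have hle : Complex.normSq (g i'.castSucc (Fin.last p)) ≤
            ∑ k : Fin p, Complex.normSq (g k.castSucc (Fin.last p)) :=
          Finset.single_le_sum (fun k _ ↦ hnn _ _) (Finset.mem_univ i')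
        linarith
      · exact le_rfl
  -- conclude with `‖z‖ = sqrt (normSq z)`
  have h3 : ‖g i j‖ ^ 2 ≤ ‖g (Fin.last p) (Fin.last p)‖ ^ 2 := by
    rw [← Complex.normSq_eq_norm_sq, ← Complex.normSq_eq_norm_sq]
    exact key
  exact (pow_le_pow_iff_left₀ (norm_nonneg _) (norm_nonneg _) two_ne_zero).1 h3

end Summit.HodgeConjecture.HodgeConjecture.Cruxes.OrthogonalEnveloped.HeckeGraphChow

end
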